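import Summits.HodgeConjecture.HodgeConjecture.Theorems.TropicalWeilObstructionTropicalWeilVanishingVariationalDirectionBound
import Summits.HodgeConjecture.HodgeConjecture.Theorems.TropicalWeilObstructionTropicalWeilVanishingClassPositivityPSDCone
import HarnessLib

/-!
# Route `TropicalWeilObstruction` (Kontsevich's tropical test — NEGATION SINK, exploration, no summit claim):
# the VARIATIONAL direction bound — the Weil tables are rank one, and the class tables of EVERY class are independent

Negation-sink bookkeeping of the cell `pub-hodge-tropical` (seat tropical-2 gen 8, refereeing tropical-1 gen 9's VARIATIONAL series
p351664 / p352081 / p352543; referee finding R-V1 of the cell's `REFEREE-K1K2.md`, made kernel-exact; part A of two). Part III of that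
series (`card_image_pluckerCoord_ge_of_independent_directions`) turns `N` integer directions `D_i ∈ Sym_J(ℤ)` and `N` coordinate pairs
`(S_j, S'_j)` with an independent minor matrix `det D_i[S_j, S'_j]` into `≥ N` pairwise distinct `4`-planes of an effective tropical
`4`-cycle at a very general Weil period — PROVIDED the Weil part `b Re w(D_i) + c Im w(D_i)` of the class tables vanishes on the chosen
coordinates (Ω-invisible columns: certified `N = 607`; or `W(Z) = 0`: certified `N = 626`). This file proves the linear algebra that
removes the proviso (part B, `…VariationalUniform`, draws the consequences):

* `weilClassC_direction_apply` — for `DJ = JD` the complex Weil table is a RANK-ONE multiple of a fixed table,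
  `w(D)(S,S') = det(M_D) · Ω(S) Ω(S')` (`M_D = ½ P D Pᴴ`; eigenwave identity `DΩ = Ω M_D`, p334819);
* `sum_det_submatrix_mul_omegaMinor` — `Σ_{S'} det D[S,S'] Ω(S') = 24 det(M_D) Ω(S)` (all-maps Cauchy–Binet): the coefficient
  `det(M_D)` is the value of a FIXED LINEAR FUNCTIONAL `ℓ(X) = Σ_{S,S'} conj(Ω(S)) X(S,S') Ω(S')` on the theta table, up to `9216`
  (`sum_weight_mul_thetaTable`);
* with p343407's `Kappa.sum_star_omega_mul_omega` (`Σ_S |Ω(S)|² = 384`) and `Kappa.sum_omega_mul_omega` (`Σ_S Ω(S)² = 0`: the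
  `(4,0)`-frame is ISOTROPIC, `ΩᵀΩ = 0`), `ℓ` kills `Re(Ω⊗Ω)`, `Im(Ω⊗Ω)` and the Weil tables of every direction
  (`sum_weight_mul_reOmega`, `sum_weight_mul_imOmega`, `ell_weilClassRe_direction`, `ell_weilClassIm_direction`), and
  `ℓ(a θ₄(D) + b Re w(D) + c Im w(D)) = 9216 · a · det(M_D)` (`ell_classTable`, via `ell_sum_smul`);
* **`linearIndependent_classTables_real`, `linearIndependent_classTables`** — the class tables `a θ₄(D_i) + b Re w(D_i) + c Im w(D_i)`
  of ANY class with `a ≠ 0` are linearly independent as soon as the theta minors are independent on ANY coordinates (apply `ℓ` to a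
  vanishing combination: `Σ g_i det(M_{D_i}) = 0`, so the Weil parts cancel pointwise and `a Σ g_i θ₄(D_i) = 0`).

On paper this is the remark that `V(a,b,c) = Ψ(V₀)` with `Ψ = a·id + C_{b,c} ⊗ ℓ` injective for `a ≠ 0` because `ℓ(C_{b,c}) = 0`, so
`dim V(a,b,c) = dim V₀` (= 626, a certified computation) for every class — no computed input is needed for the uniformity. HONEST
STATUS. Linear algebra about the class tables of the tropical Weil family; nothing here decides K1 (stmt-HodgeConjecture-18478, OPEN) or
bears on the Hodge conjecture in either direction. No definition, no named fact, no sorry.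

References: [Zharkov2020TropicalWeil] I. Zharkov, arXiv:2002.02347, §2 (pp. 2–4); [MikhalkinZharkov2014Eigenwave] G. Mikhalkin,
I. Zharkov, LN UMI 15 (2014), Def. 4.2, Prop. 4.3, Thm. 5.4.
-/

set_option linter.dupNamespace false

noncomputable section

open scoped BigOperators Topology
open Matrix Filter
open Literature.AlgebraicGeometry.Tropical
open Summit.HodgeConjecture.HodgeConjecture.Theorems.TropicalHodgeBound

namespace Summit.HodgeConjecture.HodgeConjecture.Theorems.TropicalWeilVanishing.Variational

/-! ## §0 Display-only notation (the K3 skeleton's local definitions, verbatim bodies; nothing is defined) -/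

/-- `P = [1 | i·1]`, the `n × 2n` matrix of `dz₁ ∧ … ∧ dz_n`. -/
local notation3 (prettyPrint := false) "𝐏⟦" n "⟧" =>
  (Matrix.of fun (k : Fin n) (a : Fin (2 * n)) =>
    (if (a : ℕ) = (k : ℕ) then (1 : ℂ) else 0) + (if (a : ℕ) = (k : ℕ) + n then Complex.I else 0))

/-- The skeleton's `thetaClass n Q`. -/
local notation3 (prettyPrint := false) "θ⟦" n "⟧" Q:max =>
  (fun S S' : Fin n → Fin (2 * n) => Matrix.det (Matrix.submatrix Q S S'))

/-- The skeleton's `omegaFrame n` (`Ω = Pᴴ`). -/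
local notation3 (prettyPrint := false) "Ω⟦" n "⟧" =>
  (Matrix.of fun (a : Fin (2 * n)) (b : Fin n) =>
    (if (a : ℕ) = (b : ℕ) then (1 : ℂ) else 0) - (if (a : ℕ) = (b : ℕ) + n then Complex.I else 0))

/-- The skeleton's `weilClassC n Q` (`w(Q) = (⋀ⁿQ ⊗ 1)(Ω ⊗ Ω)`). -/
local notation3 (prettyPrint := false) "wC⟦" n "⟧" Q:max =>
  (fun S S' : Fin n → Fin (2 * n) =>
    Matrix.det (Matrix.submatrix (Matrix.map Q ((↑) : ℝ → ℂ) * Ω⟦n⟧) S id) *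
      Matrix.det (Matrix.submatrix (Ω⟦n⟧) S' id))

/-- The skeleton's `weilClassRe n Q` (`w₁ = Re w`). -/
local notation3 (prettyPrint := false) "wRe⟦" n "⟧" Q:max =>
  (fun S S' : Fin n → Fin (2 * n) => Complex.re ((wC⟦n⟧ Q) S S'))

/-- The skeleton's `weilClassIm n Q` (`w₂ = Im w`). -/
local notation3 (prettyPrint := false) "wIm⟦" n "⟧" Q:max =>
  (fun S S' : Fin n → Fin (2 * n) => Complex.im ((wC⟦n⟧ Q) S S'))

/-- `M_Q = ½ P Q Pᴴ` (the complex `n × n` matrix through which a `J`-commuting `Q` acts on `Ω`). -/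
local notation3 (prettyPrint := false) "𝐌⟦" n "⟧" Q:max =>
  ((2 : ℂ)⁻¹ • (𝐏⟦n⟧ * Matrix.map Q ((↑) : ℝ → ℂ) * (𝐏⟦n⟧)ᴴ))

/-- `Ω(S) = det Ω[S, ·]`, the Plücker coordinate of the complex frame `Ω` at the word `S`. -/
local notation3 (prettyPrint := false) "Ωm" S:max => (Matrix.det (Matrix.submatrix (Ω⟦4⟧) S id))

variable (Q : Matrix (Fin (2 * 4)) (Fin (2 * 4)) ℝ)

/-! ## §1 The Weil table of a direction is `det(M_D) · Ω ⊗ Ω`; `det(M_D)` is a linear functional of the theta table -/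

/-- **`w(D) = det(M_D) · Ω ⊗ Ω`** for every `J`-commuting real `D` (`DΩ = Ω M_D`, p334819). [cite: Zharkov2020TropicalWeil, §2 (pp. 2–4)] -/
theorem weilClassC_direction_apply (D : Matrix (Fin (2 * 4)) (Fin (2 * 4)) ℝ) (hDJ : D * weilJ 4 = weilJ 4 * D)
    (S S' : Fin 4 → Fin (2 * 4)) : (wC⟦4⟧ D) S S' = (𝐌⟦4⟧ D).det * Ωm S * Ωm S' := by
  show Matrix.det (Matrix.submatrix (D.map ((↑) : ℝ → ℂ) * Ω⟦4⟧) S id) * Ωm S' = _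
  rw [map_mul_omega_eq_omega_mul D hDJ,
    show (Ω⟦4⟧ * 𝐌⟦4⟧ D).submatrix S id = (Ω⟦4⟧).submatrix S id * 𝐌⟦4⟧ D from rfl, Matrix.det_mul]
  ring

/-- **`Σ_{S'} det D[S,S'] · Ω(S') = 24 · det(M_D) · Ω(S)`** (all-maps Cauchy–Binet against `Ω`; p339280's
`sum_det_inv_submatrix_mul_omega` for an arbitrary `J`-commuting `D`). [cite: Zharkov2020TropicalWeil, §2 (pp. 2–4)] -/
theorem sum_det_submatrix_mul_omegaMinor (D : Matrix (Fin (2 * 4)) (Fin (2 * 4)) ℝ) (hDJ : D * weilJ 4 = weilJ 4 * D)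
    (S : Fin 4 → Fin (2 * 4)) :
    ∑ S' : Fin 4 → Fin (2 * 4), (((D.submatrix S S').det : ℝ) : ℂ) * Ωm S' = 24 * ((𝐌⟦4⟧ D).det * Ωm S) := by
  have h := sum_det_submatrix_mul_det_submatrix ((D.map ((↑) : ℝ → ℂ)).submatrix S id) (Ω⟦4⟧)
  simp only [Matrix.submatrix_submatrix, Function.comp_id, Function.id_comp] at h
  have hcast : ∀ S' : Fin 4 → Fin (2 * 4),
      (((D.submatrix S S').det : ℝ) : ℂ) = ((D.map ((↑) : ℝ → ℂ)).submatrix S S').det := by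
    intro S'; rw [ofReal_det]; rfl
  simp_rw [hcast]
  have hsub : (D.map ((↑) : ℝ → ℂ)).submatrix S id * Ω⟦4⟧ = ((D.map ((↑) : ℝ → ℂ)) * Ω⟦4⟧).submatrix S id := by
    rw [Matrix.submatrix_mul _ _ _ _ _ Function.bijective_id, Matrix.submatrix_id_id]
  rw [h, hsub, map_mul_omega_eq_omega_mul D hDJ,
    show (Ω⟦4⟧ * 𝐌⟦4⟧ D).submatrix S id = (Ω⟦4⟧).submatrix S id * 𝐌⟦4⟧ D from rfl, Matrix.det_mul]
  norm_num [Nat.factorial]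
  ring

/-! ## §2 One more sum over words: `Σ_S conj(Ω(S))² = 0` (the two basic ones, `Σ|Ω|² = 384` and `Σ Ω² = 0`, are p343407's
`Kappa.sum_star_omega_mul_omega`, `Kappa.sum_omega_mul_omega`) -/

/-- `Σ_S conj(Ω(S))² = 0` (conjugate of `Kappa.sum_omega_mul_omega`: the `(4,0)`-frame is isotropic, `ΩᵀΩ = 0`). [folklore] -/
theorem sum_conj_omegaMinor_mul_conj_omegaMinor :
    ∑ S : Fin 4 → Fin (2 * 4), (starRingEnd ℂ) (Ωm S) * (starRingEnd ℂ) (Ωm S) = 0 := by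
  have h := congrArg (starRingEnd ℂ) Kappa.sum_omega_mul_omega
  rw [map_sum, map_zero] at h
  simpa only [map_mul] using h

/-! ## §3 The functional `ℓ(X) = Σ_{S,S'} conj(Ω(S)) X(S,S') Ω(S')` on real tables: values on `θ₄(D)`, `Re(Ω⊗Ω)`, `Im(Ω⊗Ω)` -/

/-- `ℓ(θ₄(D)) = 9216 · det(M_D)` for `DJ = JD` (`9216 = 24 · 384`). [cite: Zharkov2020TropicalWeil, §2 (pp. 2–4)] -/
theorem sum_weight_mul_thetaTable (D : Matrix (Fin (2 * 4)) (Fin (2 * 4)) ℝ) (hDJ : D * weilJ 4 = weilJ 4 * D) :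
    ∑ S : Fin 4 → Fin (2 * 4), ∑ S' : Fin 4 → Fin (2 * 4),
        (starRingEnd ℂ) (Ωm S) * (((θ⟦4⟧ D) S S' : ℝ) : ℂ) * Ωm S' = 9216 * (𝐌⟦4⟧ D).det := by
  have h1 : ∀ S : Fin 4 → Fin (2 * 4), ∑ S' : Fin 4 → Fin (2 * 4), (starRingEnd ℂ) (Ωm S) * (((θ⟦4⟧ D) S S' : ℝ) : ℂ) * Ωm S' =
      (starRingEnd ℂ) (Ωm S) * (24 * ((𝐌⟦4⟧ D).det * Ωm S)) := by
    intro S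
    rw [← sum_det_submatrix_mul_omegaMinor D hDJ S, Finset.mul_sum]
    exact Finset.sum_congr rfl fun S' _ => by ring
  simp_rw [h1]
  have h2 : ∀ S : Fin 4 → Fin (2 * 4), (starRingEnd ℂ) (Ωm S) * (24 * ((𝐌⟦4⟧ D).det * Ωm S)) =
      (24 * (𝐌⟦4⟧ D).det) * ((starRingEnd ℂ) (Ωm S) * Ωm S) := fun S => by ring
  simp_rw [h2]
  rw [← Finset.mul_sum, Kappa.sum_star_omega_mul_omega]
  ring

/-- `ℓ(Re(Ω⊗Ω)) = 0`. [folklore] -/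
theorem sum_weight_mul_reOmega :
    ∑ S : Fin 4 → Fin (2 * 4), ∑ S' : Fin 4 → Fin (2 * 4),
        (starRingEnd ℂ) (Ωm S) * (((Ωm S * Ωm S').re : ℝ) : ℂ) * Ωm S' = 0 := by
  have hre : ∀ S S' : Fin 4 → Fin (2 * 4), (((Ωm S * Ωm S').re : ℝ) : ℂ) =
      (Ωm S * Ωm S' + (starRingEnd ℂ) (Ωm S) * (starRingEnd ℂ) (Ωm S')) / 2 := by
    intro S S'
    rw [Complex.re_eq_add_conj, map_mul]
  simp_rw [hre]
  have h : ∀ S S' : Fin 4 → Fin (2 * 4),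
      (starRingEnd ℂ) (Ωm S) * ((Ωm S * Ωm S' + (starRingEnd ℂ) (Ωm S) * (starRingEnd ℂ) (Ωm S')) / 2) * Ωm S' =
        (1 / 2) * (((starRingEnd ℂ) (Ωm S) * Ωm S) * (Ωm S' * Ωm S')) +
          (1 / 2) * (((starRingEnd ℂ) (Ωm S) * (starRingEnd ℂ) (Ωm S)) * ((starRingEnd ℂ) (Ωm S') * Ωm S')) := by
    intro S S'; ring
  simp_rw [h, Finset.sum_add_distrib, ← Finset.mul_sum, ← Finset.sum_mul,
    Kappa.sum_omega_mul_omega, sum_conj_omegaMinor_mul_conj_omegaMinor]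
  ring

/-- `ℓ(Im(Ω⊗Ω)) = 0`. [folklore] -/
theorem sum_weight_mul_imOmega :
    ∑ S : Fin 4 → Fin (2 * 4), ∑ S' : Fin 4 → Fin (2 * 4),
        (starRingEnd ℂ) (Ωm S) * (((Ωm S * Ωm S').im : ℝ) : ℂ) * Ωm S' = 0 := by
  have him : ∀ S S' : Fin 4 → Fin (2 * 4), (((Ωm S * Ωm S').im : ℝ) : ℂ) =
      (Ωm S * Ωm S' - (starRingEnd ℂ) (Ωm S) * (starRingEnd ℂ) (Ωm S')) / (2 * Complex.I) := by
    intro S S'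
    rw [Complex.im_eq_sub_conj, map_mul]
  simp_rw [him]
  have h : ∀ S S' : Fin 4 → Fin (2 * 4),
      (starRingEnd ℂ) (Ωm S) * ((Ωm S * Ωm S' - (starRingEnd ℂ) (Ωm S) * (starRingEnd ℂ) (Ωm S')) / (2 * Complex.I)) * Ωm S' =
        (1 / (2 * Complex.I)) * (((starRingEnd ℂ) (Ωm S) * Ωm S) * (Ωm S' * Ωm S')) -
          (1 / (2 * Complex.I)) * (((starRingEnd ℂ) (Ωm S) * (starRingEnd ℂ) (Ωm S)) * ((starRingEnd ℂ) (Ωm S') * Ωm S')) := by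
    intro S S'; ring
  simp_rw [h, Finset.sum_sub_distrib, ← Finset.mul_sum, ← Finset.sum_mul,
    Kappa.sum_omega_mul_omega, sum_conj_omegaMinor_mul_conj_omegaMinor]
  ring

/-! ## §4 The functional `ℓ` is linear and kills the Weil tables of every direction -/

/-- `ℓ(X) := Σ_{S,S'} conj(Ω(S)) · X(S,S') · Ω(S')` on real tables (display-only notation). -/
local notation3 (prettyPrint := false) "ℒ" X:max =>
  (∑ S : Fin 4 → Fin (2 * 4), ∑ S' : Fin 4 → Fin (2 * 4),
    (starRingEnd ℂ) (Ωm S) * ((((X : (Fin 4 → Fin (2 * 4)) → (Fin 4 → Fin (2 * 4)) → ℝ) S S' : ℝ)) : ℂ) * Ωm S')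

/-- `ℓ` of a real combination of tables. [folklore] -/
theorem ell_sum_smul {ι : Type*} (s : Finset ι) (g : ι → ℝ)
    (X : ι → (Fin 4 → Fin (2 * 4)) → (Fin 4 → Fin (2 * 4)) → ℝ) :
    ℒ (∑ i ∈ s, g i • X i) = ∑ i ∈ s, ((g i : ℝ) : ℂ) * ℒ (X i) := by
  classical
  have hpt : ∀ S S' : Fin 4 → Fin (2 * 4), (∑ i ∈ s, g i • X i) S S' = ∑ i ∈ s, g i * X i S S' := by
    intro S S'
    simp only [Finset.sum_apply, Pi.smul_apply, smul_eq_mul]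
  simp_rw [hpt]
  push_cast
  have hr : ∀ i ∈ s, ((g i : ℝ) : ℂ) * (∑ S : Fin 4 → Fin (2 * 4), ∑ S' : Fin 4 → Fin (2 * 4),
      (starRingEnd ℂ) (Ωm S) * ((X i S S' : ℝ) : ℂ) * Ωm S') =
      ∑ S : Fin 4 → Fin (2 * 4), ∑ S' : Fin 4 → Fin (2 * 4),
        (starRingEnd ℂ) (Ωm S) * (((g i : ℝ) : ℂ) * ((X i S S' : ℝ) : ℂ)) * Ωm S' := by
    intro i _
    rw [Finset.mul_sum]
    refine Finset.sum_congr rfl fun S _ => ?_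
    rw [Finset.mul_sum]
    refine Finset.sum_congr rfl fun S' _ => ?_
    ring
  rw [Finset.sum_congr rfl hr]
  conv_rhs => rw [Finset.sum_comm]
  refine Finset.sum_congr rfl fun S _ => ?_
  conv_rhs => rw [Finset.sum_comm]
  refine Finset.sum_congr rfl fun S' _ => ?_
  rw [Finset.mul_sum, Finset.sum_mul]

/-- `ℓ(Re w(D)) = 0` for every `J`-commuting `D`. [cite: Zharkov2020TropicalWeil, §2 (pp. 2–4)] -/
theorem ell_weilClassRe_direction (D : Matrix (Fin (2 * 4)) (Fin (2 * 4)) ℝ) (hDJ : D * weilJ 4 = weilJ 4 * D) :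
    ℒ (wRe⟦4⟧ D) = 0 := by
  have hpt : ∀ S S' : Fin 4 → Fin (2 * 4), (wRe⟦4⟧ D) S S' =
      (𝐌⟦4⟧ D).det.re * (Ωm S * Ωm S').re - (𝐌⟦4⟧ D).det.im * (Ωm S * Ωm S').im := by
    intro S S'
    show ((wC⟦4⟧ D) S S').re = _
    rw [weilClassC_direction_apply D hDJ S S', mul_assoc, Complex.mul_re]
  simp_rw [hpt]
  push_cast
  have h : ∀ S S' : Fin 4 → Fin (2 * 4),
      (starRingEnd ℂ) (Ωm S) * ((((𝐌⟦4⟧ D).det.re : ℝ) : ℂ) * ((((Ωm S * Ωm S').re : ℝ)) : ℂ) -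
        ((((𝐌⟦4⟧ D).det.im : ℝ)) : ℂ) * ((((Ωm S * Ωm S').im : ℝ)) : ℂ)) * Ωm S' =
      ((((𝐌⟦4⟧ D).det.re : ℝ)) : ℂ) * ((starRingEnd ℂ) (Ωm S) * ((((Ωm S * Ωm S').re : ℝ)) : ℂ) * Ωm S') -
        ((((𝐌⟦4⟧ D).det.im : ℝ)) : ℂ) * ((starRingEnd ℂ) (Ωm S) * ((((Ωm S * Ωm S').im : ℝ)) : ℂ) * Ωm S') := by
    intro S S'; ring
  simp_rw [h, Finset.sum_sub_distrib, ← Finset.mul_sum, sum_weight_mul_reOmega, sum_weight_mul_imOmega]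
  simp

/-- `ℓ(Im w(D)) = 0` for every `J`-commuting `D`. [cite: Zharkov2020TropicalWeil, §2 (pp. 2–4)] -/
theorem ell_weilClassIm_direction (D : Matrix (Fin (2 * 4)) (Fin (2 * 4)) ℝ) (hDJ : D * weilJ 4 = weilJ 4 * D) :
    ℒ (wIm⟦4⟧ D) = 0 := by
  have hpt : ∀ S S' : Fin 4 → Fin (2 * 4), (wIm⟦4⟧ D) S S' =
      (𝐌⟦4⟧ D).det.re * (Ωm S * Ωm S').im + (𝐌⟦4⟧ D).det.im * (Ωm S * Ωm S').re := by
    intro S S'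
    show ((wC⟦4⟧ D) S S').im = _
    rw [weilClassC_direction_apply D hDJ S S', mul_assoc, Complex.mul_im]
  simp_rw [hpt]
  push_cast
  have h : ∀ S S' : Fin 4 → Fin (2 * 4),
      (starRingEnd ℂ) (Ωm S) * ((((𝐌⟦4⟧ D).det.re : ℝ) : ℂ) * ((((Ωm S * Ωm S').im : ℝ)) : ℂ) +
        ((((𝐌⟦4⟧ D).det.im : ℝ)) : ℂ) * ((((Ωm S * Ωm S').re : ℝ)) : ℂ)) * Ωm S' =
      ((((𝐌⟦4⟧ D).det.re : ℝ)) : ℂ) * ((starRingEnd ℂ) (Ωm S) * ((((Ωm S * Ωm S').im : ℝ)) : ℂ) * Ωm S') +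
        ((((𝐌⟦4⟧ D).det.im : ℝ)) : ℂ) * ((starRingEnd ℂ) (Ωm S) * ((((Ωm S * Ωm S').re : ℝ)) : ℂ) * Ωm S') := by
    intro S S'; ring
  simp_rw [h, Finset.sum_add_distrib, ← Finset.mul_sum, sum_weight_mul_reOmega, sum_weight_mul_imOmega]
  simp

/-- `ℓ` of a class table: `ℓ(a θ₄(D) + b Re w(D) + c Im w(D)) = 9216 · a · det(M_D)`. [cite: Zharkov2020TropicalWeil, §2 (pp. 2–4)] -/
theorem ell_classTable (D : Matrix (Fin (2 * 4)) (Fin (2 * 4)) ℝ) (hDJ : D * weilJ 4 = weilJ 4 * D) (a b c : ℝ) :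
    ℒ (a • θ⟦4⟧ D + b • wRe⟦4⟧ D + c • wIm⟦4⟧ D) = 9216 * ((a : ℝ) : ℂ) * (𝐌⟦4⟧ D).det := by
  have h3 : (a • θ⟦4⟧ D + b • wRe⟦4⟧ D + c • wIm⟦4⟧ D : (Fin 4 → Fin (2 * 4)) → (Fin 4 → Fin (2 * 4)) → ℝ) =
      ∑ i : Fin 3, (![a, b, c] i) •
        ((![θ⟦4⟧ D, wRe⟦4⟧ D, wIm⟦4⟧ D] : Fin 3 → (Fin 4 → Fin (2 * 4)) → (Fin 4 → Fin (2 * 4)) → ℝ) i) := by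
    simp [Fin.sum_univ_three]
  rw [h3, ell_sum_smul]
  simp only [Fin.sum_univ_three, Matrix.cons_val_zero, Matrix.cons_val_one, Matrix.head_cons,
    Matrix.cons_val_two, Matrix.tail_cons]
  rw [sum_weight_mul_thetaTable D hDJ, ell_weilClassRe_direction D hDJ, ell_weilClassIm_direction D hDJ]
  ring

/-! ## §5 Independence of the class tables for EVERY class with `a ≠ 0` -/

/-- **The class tables of independent directions are independent for every class with `a ≠ 0`** (real directions). If the minor
matrix `det D_i[S_j, S'_j]` of `N` `J`-commuting real directions has independent rows on SOME `N` coordinate pairs, then for all real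
`a ≠ 0`, `b`, `c` the `N` tables `a θ₄(D_i) + b Re w(D_i) + c Im w(D_i)` are linearly independent (apply `ℓ` to a vanishing
combination: `Σ g_i det(M_{D_i}) = 0`, so the Weil parts — real parts of multiples of `(Σ g_i det M_{D_i}) Ω⊗Ω` — cancel, and the theta
parts vanish on the chosen coordinates). [cite: Zharkov2020TropicalWeil, §2 (pp. 2–4)] [cite: MikhalkinZharkov2014Eigenwave, Prop. 4.3 and Thm. 5.4] -/
theorem linearIndependent_classTables_real {N : ℕ} (D : Fin N → Matrix (Fin (2 * 4)) (Fin (2 * 4)) ℝ)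
    (hDJ : ∀ i, D i * weilJ 4 = weilJ 4 * D i) (a b c : ℝ) (ha : a ≠ 0)
    (col : Fin N → (Fin 4 → Fin (2 * 4)) × (Fin 4 → Fin (2 * 4)))
    (hind : LinearIndependent ℝ fun i : Fin N => fun j : Fin N =>
      Matrix.det (Matrix.submatrix (D i) (col j).1 (col j).2)) :
    LinearIndependent ℝ fun i : Fin N => a • θ⟦4⟧ (D i) + b • wRe⟦4⟧ (D i) + c • wIm⟦4⟧ (D i) := by
  classical
  obtain ⟨m, hm⟩ : ∃ m : Fin N → ℂ, ∀ i, (𝐌⟦4⟧ (D i)).det = m i := ⟨_, fun i => rfl⟩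
  rw [Fintype.linearIndependent_iff]
  intro g hg
  -- Step 1: apply ℓ — `Σ_i g_i det(M_{D_i}) = 0`
  have hℓ : ∑ i, ((g i : ℝ) : ℂ) * m i = 0 := by
    have h := congrArg (fun X : (Fin 4 → Fin (2 * 4)) → (Fin 4 → Fin (2 * 4)) → ℝ => ℒ X) hg
    simp only at h
    rw [ell_sum_smul] at h
    have hz : (ℒ (0 : (Fin 4 → Fin (2 * 4)) → (Fin 4 → Fin (2 * 4)) → ℝ)) = 0 := by simp
    rw [hz] at h
    have e : ∀ i, ((g i : ℝ) : ℂ) * ℒ (a • θ⟦4⟧ (D i) + b • wRe⟦4⟧ (D i) + c • wIm⟦4⟧ (D i)) =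
        (9216 * ((a : ℝ) : ℂ)) * (((g i : ℝ) : ℂ) * m i) := by
      intro i; rw [ell_classTable (D i) (hDJ i) a b c, hm i]; ring
    simp_rw [e] at h
    rw [← Finset.mul_sum] at h
    have ha' : (9216 * ((a : ℝ) : ℂ)) ≠ 0 := mul_ne_zero (by norm_num) (by exact_mod_cast ha)
    exact (mul_eq_zero.1 h).resolve_left ha'
  -- Step 2: pointwise, the Weil parts cancel, so the theta parts vanish
  have hθ : ∀ S S' : Fin 4 → Fin (2 * 4), ∑ i, g i * (θ⟦4⟧ (D i)) S S' = 0 := by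
    intro S S'
    have h := congrFun (congrFun hg S) S'
    simp only [Finset.sum_apply, Pi.smul_apply, Pi.add_apply, smul_eq_mul, Pi.zero_apply] at h
    -- the Weil part of direction i at (S,S') is Re((b − c i) · m_i · Ω(S)Ω(S'))
    have hw : ∀ i, b * (wRe⟦4⟧ (D i)) S S' + c * (wIm⟦4⟧ (D i)) S S' =
        ((((b : ℝ) : ℂ) - ((c : ℝ) : ℂ) * Complex.I) * (m i * (Ωm S * Ωm S'))).re := by
      intro i
      show b * ((wC⟦4⟧ (D i)) S S').re + c * ((wC⟦4⟧ (D i)) S S').im = _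
      rw [weilClassC_direction_apply (D i) (hDJ i) S S', hm i, mul_assoc]
      simp only [Complex.mul_re, Complex.sub_re, Complex.sub_im, Complex.ofReal_re, Complex.ofReal_im,
        Complex.mul_im, Complex.I_re, Complex.I_im]
      ring
    have hsplit : ∑ i, g i * (a * (θ⟦4⟧ (D i)) S S' + b * (wRe⟦4⟧ (D i)) S S' + c * (wIm⟦4⟧ (D i)) S S') =
        a * ∑ i, g i * (θ⟦4⟧ (D i)) S S' +
          (∑ i, ((g i : ℝ) : ℂ) * ((((b : ℝ) : ℂ) - ((c : ℝ) : ℂ) * Complex.I) * (m i * (Ωm S * Ωm S')))).re := by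
      rw [Complex.re_sum, Finset.mul_sum, ← Finset.sum_add_distrib]
      refine Finset.sum_congr rfl fun i _ => ?_
      rw [Complex.re_ofReal_mul, ← hw i]
      ring
    have hW0 : (∑ i, ((g i : ℝ) : ℂ) * ((((b : ℝ) : ℂ) - ((c : ℝ) : ℂ) * Complex.I) * (m i * (Ωm S * Ωm S')))) = 0 := by
      have e : ∀ i, ((g i : ℝ) : ℂ) * ((((b : ℝ) : ℂ) - ((c : ℝ) : ℂ) * Complex.I) * (m i * (Ωm S * Ωm S'))) =
          ((((b : ℝ) : ℂ) - ((c : ℝ) : ℂ) * Complex.I) * (Ωm S * Ωm S')) * (((g i : ℝ) : ℂ) * m i) := by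
        intro i; ring
      simp_rw [e]
      rw [← Finset.mul_sum, hℓ, mul_zero]
    have h' : ∑ i, g i * (a * (θ⟦4⟧ (D i)) S S' + b * (wRe⟦4⟧ (D i)) S S' + c * (wIm⟦4⟧ (D i)) S S') = 0 := by
      simpa only [Pi.add_apply, Pi.smul_apply, smul_eq_mul] using h
    rw [hsplit, hW0, Complex.zero_re, add_zero] at h'
    exact (mul_eq_zero.1 h').resolve_left ha
  -- Step 3: read the theta parts on the chosen coordinates
  have key : ∑ i, g i • (fun j : Fin N => Matrix.det (Matrix.submatrix (D i) (col j).1 (col j).2)) = 0 := by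
    funext j
    simp only [Finset.sum_apply, Pi.smul_apply, smul_eq_mul, Pi.zero_apply]
    exact hθ (col j).1 (col j).2
  exact Fintype.linearIndependent_iff.1 hind g key

/-- **The class tables of independent INTEGER directions are independent for every class with `a ≠ 0`** (the form the cell's
certificates discharge: integer minors cast to `ℝ`). [cite: Zharkov2020TropicalWeil, §2 (pp. 2–4)]
[cite: MikhalkinZharkov2014Eigenwave, Prop. 4.3 and Thm. 5.4] -/
theorem linearIndependent_classTables {N : ℕ} (D : Fin N → Matrix (Fin (2 * 4)) (Fin (2 * 4)) ℤ)
    (hDJ : ∀ i, (D i).map ((↑) : ℤ → ℝ) * weilJ 4 = weilJ 4 * (D i).map ((↑) : ℤ → ℝ))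
    (a b c : ℝ) (ha : a ≠ 0)
    (col : Fin N → (Fin 4 → Fin (2 * 4)) × (Fin 4 → Fin (2 * 4)))
    (hind : LinearIndependent ℝ fun i : Fin N => fun j : Fin N =>
      ((Matrix.det (Matrix.submatrix (D i) (col j).1 (col j).2) : ℤ) : ℝ)) :
    LinearIndependent ℝ fun i : Fin N =>
      a • θ⟦4⟧ ((D i).map ((↑) : ℤ → ℝ)) + b • wRe⟦4⟧ ((D i).map ((↑) : ℤ → ℝ)) +
        c • wIm⟦4⟧ ((D i).map ((↑) : ℤ → ℝ)) := by
  refine linearIndependent_classTables_real (fun i => (D i).map ((↑) : ℤ → ℝ)) hDJ a b c ha col ?_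
  have e2 : ∀ i j, Matrix.det (Matrix.submatrix ((D i).map ((↑) : ℤ → ℝ)) (col j).1 (col j).2) =
      ((Matrix.det (Matrix.submatrix (D i) (col j).1 (col j).2) : ℤ) : ℝ) := by
    intro i j
    have e1 : Matrix.submatrix ((D i).map ((↑) : ℤ → ℝ)) (col j).1 (col j).2 =
        (Int.castRingHom ℝ).mapMatrix (Matrix.submatrix (D i) (col j).1 (col j).2) := by
      ext; rfl
    rw [e1, ← RingHom.map_det, eq_intCast]
  simp_rw [e2]
  exact hind

end Summit.HodgeConjecture.HodgeConjecture.Theorems.TropicalWeilVanishing.Variational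

end
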